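import Summits.QuantumFields.YangMills.Theorems.DiagonalMirrorRPRWilsonDiagonalModelOpenLink
import Summits.QuantumFields.YangMills.Theorems.DiagonalMirrorRPRWilsonDiagonalModelChainKernel

/-!
# Crux `WeakCouplingHypercubicLimitRP` (stmt-QuantumFields-27398) / aside `DiagonalMirrorRPR` (stmt-QuantumFields-10604), door B,
# construction F1_diag — PAIRING LAYER, step P3b: the `K_u`-chain WITH AN OBSERVABLE INSERTED, rewritten over lifted sites

Helper file (`--supports stmt-QuantumFields-27398 --as helper`) of the hand `hand-10604-wilsonDiagModel-2` (docket director-ym O4 WORD 16 (1) /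
28, step P3 of hand-1's ROADMAP-F1diag v4 §1⅞); it closes nothing by itself.

WHAT.  Hand-1 rewrote the bare cyclic chain `Tr K_u^m = ∫ ∏_t e^{β even_t} e^{β odd_t} dP` as the cyclic integral of the reweighted lifted kernel
`𝔟` over `μ̃^{⊗m}` (`…ChainKernel`, `…Reweight`).  Here the same is done with an arbitrary bounded measurable OBSERVABLE `Ω(P)` of the
pair string `P_t = (Y_t, X_t)` inserted, keeping the bond half layers `Y` unintegrated inside the open links:
* §1 `integral_tMeasure_pi_eq_tsum` — `∫ G dμ̃^{⊗ι} = Σ'_k ∫_X (∏_t w_{k_t}) G(k, X) dX` for bounded measurable `G` (the reweighting, general form);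
* §2 `prod_featWeight_mul_prod_openLink` — around the cycle `(∏_t w_{k_t}) ∏_t openLink(V_{t-1}, V_t)(Y_t) = (∏_t e^{β inslab X_t}) ∏_t linkFactor_t(Y_t)`;
* §3 ★ **`integral_obs_mul_pairChain_eq`** — for `β ≥ 0`, `ρ` continuous unitary, `|w(Y)_j| ≤ M`:
  `∫ Ω(P) ∏_t e^{β even_t} e^{β odd_t} dP = ∫ [∫ (∏_t openLink(V_{t-1}, V_t)(Y_t)) Ω((Y_t, X(V_t))_t) dY] dμ̃^{⊗ℤ/mℤ}(V)`
  (feature expansion of every even step `…ChainTonelli`, dominated interchange as in `…ChainFubini`, zip/Fubini as in `…ChainKernel`, reweighting §1).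
  With `Ω ≡ 1` this is hand-1's trace identity; with `Ω = Θf · f` it is the input of the block factorisation (`…BlockChain`).

HONEST FRAMING: bookkeeping of the pairing layer; `wilsonDiagonalModel` is NOT landed here; no letter is proved; D1, ⟨27398⟩, S6i and the aside
⟨10604⟩ are OPEN; nothing here bears on the summit; the Yang–Mills mass gap is NOT proved here or anywhere in the tree.  No definition, no
instance, no notation, `autoImplicit false`.

References: K. Osterwalder, E. Seiler, Ann. Phys. 110 (1978) §2–3; E. Seiler, LNP 159 (1982) Ch. 2.
-/

set_option autoImplicit false

noncomputable section

open scoped BigOperators ENNReal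
open MeasureTheory Function
open Literature.MathematicalPhysics.QuantumLattice Literature.MathematicalPhysics.QuantumFieldTheory
open Summit.QuantumFields.YangMills.Cruxes.DiagonalMirrorRPR.ParityBridgeColdTraces

namespace Summit.QuantumFields.YangMills.Cruxes.DiagonalMirrorRPR.SignTwistedDiagonalTrace.WilsonDiagonal

/-! ## §1 Integrals over `μ̃^{⊗ι}` as weighted sums of integrals over `halfHaar^{⊗ι}` -/

section Reweight

variable {S : ℕ} [NeZero S] {G : Type} [Group G] {Nc : ℕ}
variable [TopologicalSpace G] [IsTopologicalGroup G] [CompactSpace G] [MeasurableSpace G] [BorelSpace G]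

/-- **Reweighting, general form**: for a bounded measurable `G` on `(ℕ × HalfCfg)^ι`,
`∫ G dμ̃^{⊗ι} = Σ'_{k ∈ ℕ^ι} ∫_X (∏_t w_{k_t}) · G((k_t, X_t)_t) d(halfHaar)^{⊗ι}` (zip, Fubini, the discrete factor is a weighted sum). -/
theorem integral_tMeasure_pi_eq_tsum {β : ℝ} (hβ : 0 ≤ β) (M : ℝ) {ι : Type} [Fintype ι]
    {F : (ι → ℕ × HalfCfg S S G) → ℝ} (hF : Measurable F) {B : ℝ} (hB : ∀ V, |F V| ≤ B) :
    ∫ V, F V ∂(Measure.pi fun _ : ι => tMeasure S G Nc β M) =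
      ∑' k : ι → ℕ, ∫ X : ι → HalfCfg S S G, (∏ t, featWeight (featDim S Nc) β M (k t)) * F (fun t => (k t, X t))
        ∂(Measure.pi fun _ => halfHaar S G) := by
  haveI := isFiniteMeasure_wMeasure (featDim S Nc) hβ M
  haveI : IsFiniteMeasure (halfHaar S G) := by unfold halfHaar; infer_instance
  have hmp := measurePreserving_arrowProdEquivProdArrow ℕ (HalfCfg S S G) ι
    (fun _ => wMeasure (featDim S Nc) β M) (fun _ => halfHaar S G)
  have step1 : ∫ V, F V ∂(Measure.pi fun _ : ι => tMeasure S G Nc β M) =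
      ∫ q : (ι → ℕ) × (ι → HalfCfg S S G), F (fun t => (q.1 t, q.2 t))
        ∂((Measure.pi fun _ => wMeasure (featDim S Nc) β M).prod (Measure.pi fun _ => halfHaar S G)) :=
    ((hmp.symm _).integral_comp' (fun V : ι → ℕ × HalfCfg S S G => F V)).symm
  have hm : Measurable fun q : (ι → ℕ) × (ι → HalfCfg S S G) => F (fun t => (q.1 t, q.2 t)) :=
    hF.comp (MeasurableEquiv.arrowProdEquivProdArrow ℕ (HalfCfg S S G) ι).symm.measurable
  have hf : Integrable (fun q : (ι → ℕ) × (ι → HalfCfg S S G) => F (fun t => (q.1 t, q.2 t)))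
      ((Measure.pi fun _ => wMeasure (featDim S Nc) β M).prod (Measure.pi fun _ => halfHaar S G)) :=
    Integrable.of_bound hm.aestronglyMeasurable B (ae_of_all _ fun q => by
      rw [Real.norm_eq_abs]; exact hB _)
  rw [step1, integral_prod _ hf, integral_countable hf.integral_prod_left]
  refine tsum_congr fun k => ?_
  rw [measureReal_def, Measure.pi_singleton, ENNReal.toReal_prod]
  simp only [wMeasure_singleton, ENNReal.toReal_ofReal (featWeight_pos _ _ _ _).le]
  rw [smul_eq_mul, ← integral_const_mul]

end Reweight

/-! ## §2 The cycle algebra of the open-link prefactors -/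

section CycleAlgebra

variable {S : ℕ} [NeZero S] {G : Type} [Group G] {Nc : ℕ} (ρ : G →* Matrix (Fin Nc) (Fin Nc) ℂ)

/-- **Around a cycle the open-link prefactors resum**: `(∏_t w_{k_t}) · ∏_t openLink((k_{t-1},X_{t-1}),(k_t,X_t))(Y_t)
= (∏_t e^{β inslab X_t}) · ∏_t linkFactor_k X t (Y_t)` on `ℤ/mℤ`. -/
theorem prod_featWeight_mul_prod_openLink (β M : ℝ) {m : ℕ} [NeZero m] (k : ZMod m → ℕ) (X Y : ZMod m → HalfCfg S S G) :
    (∏ t, featWeight (featDim S Nc) β M (k t)) * ∏ t, openLink ρ β M (k (t - 1), X (t - 1)) (k t, X t) (Y t) =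
      (∏ t, Real.exp (β * inslabAction ρ (X t))) * ∏ t, linkFactor ρ β k X t (Y t) := by
  -- split the open links into prefactors and cores
  have hsplit : ∀ t, openLink ρ β M (k (t - 1), X (t - 1)) (k t, X t) (Y t) =
      (Real.exp (β / 2 * inslabAction ρ (X (t - 1))) * Real.exp (β / 2 * inslabAction ρ (X t)) /
        (Real.sqrt (featWeight (featDim S Nc) β M (k (t - 1))) * Real.sqrt (featWeight (featDim S Nc) β M (k t)))) *
        linkFactor ρ β k X t (Y t) := fun t => rfl
  simp only [hsplit]
  rw [Finset.prod_mul_distrib, Finset.prod_div_distrib, Finset.prod_mul_distrib, Finset.prod_mul_distrib]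
  -- reindex the `t - 1` products
  have hE : ∏ t : ZMod m, Real.exp (β / 2 * inslabAction ρ (X (t - 1))) = ∏ t, Real.exp (β / 2 * inslabAction ρ (X t)) :=
    Fintype.prod_equiv (Equiv.subRight 1) _ _ fun t => rfl
  have hR : ∏ t : ZMod m, Real.sqrt (featWeight (featDim S Nc) β M (k (t - 1))) =
      ∏ t, Real.sqrt (featWeight (featDim S Nc) β M (k t)) :=
    Fintype.prod_equiv (Equiv.subRight 1) _ _ fun t => rfl
  rw [hE, hR]
  have hw : ∀ t, Real.sqrt (featWeight (featDim S Nc) β M (k t)) * Real.sqrt (featWeight (featDim S Nc) β M (k t)) =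
      featWeight (featDim S Nc) β M (k t) := fun t => Real.mul_self_sqrt (featWeight_pos _ β M _).le
  have he2 : ∀ t, Real.exp (β / 2 * inslabAction ρ (X t)) * Real.exp (β / 2 * inslabAction ρ (X t)) =
      Real.exp (β * inslabAction ρ (X t)) := fun t => by rw [← Real.exp_add]; congr 1; ring
  rw [← Finset.prod_mul_distrib, ← Finset.prod_mul_distrib]
  simp only [hw, he2]
  have hne : ∏ t, featWeight (featDim S Nc) β M (k t) ≠ 0 :=
    (Finset.prod_pos fun t _ => featWeight_pos _ β M (k t)).ne'
  rw [← mul_assoc, mul_div_assoc', mul_div_cancel_left₀ _ hne]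

end CycleAlgebra

/-! ## §3 ★ The chain with an observable inserted, over lifted sites -/

section ObsChain

variable {S : ℕ} [NeZero S] {G : Type} [Group G] {Nc : ℕ} (ρ : G →* Matrix (Fin Nc) (Fin Nc) ℂ)
variable [TopologicalSpace G] [IsTopologicalGroup G] [CompactSpace G] [MeasurableSpace G] [BorelSpace G]
  [SecondCountableTopology G]

/-- Step 1–2 (feature expansion + dominated interchange): for a bounded measurable observable `Ω` of the pair string,
`∫ Ω(P) ∏_t e^{β even_t} e^{β odd_t} dP = Σ'_k ∫ Ω(P) ∏_t chainFactor_k P t dP`. -/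
theorem integral_obs_mul_pairChain_eq_tsum (hρ : Continuous ρ) {β : ℝ} (hβ : 0 ≤ β)
    (hρu : ∀ g, ρ g ∈ Matrix.unitaryGroup (Fin Nc) ℂ) {m : ℕ} [NeZero m]
    {Ω : (ZMod m → HalfCfg S S G × HalfCfg S S G) → ℝ} (hΩm : Measurable Ω) {B : ℝ} (hΩb : ∀ P, |Ω P| ≤ B) :
    ∫ P : ZMod m → HalfCfg S S G × HalfCfg S S G,
        Ω P * ∏ t : ZMod m, Real.exp (β * evenActionU ρ (P t).1 (P t).2 (P (t + 1)).1) *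
          Real.exp (β * oddActionU ρ (P t).2 (P (t + 1)).1 (P (t + 1)).2)
        ∂(Measure.pi fun _ : ZMod m => (halfHaar S G).prod (halfHaar S G)) =
      ∑' k : ZMod m → ℕ, ∫ P : ZMod m → HalfCfg S S G × HalfCfg S S G, Ω P * ∏ t, chainFactor ρ β k P t
        ∂(Measure.pi fun _ : ZMod m => (halfHaar S G).prod (halfHaar S G)) := by
  haveI : IsProbabilityMeasure (halfHaar S G) := by unfold halfHaar; infer_instance
  have hB0 : 0 ≤ B := (abs_nonneg _).trans (hΩb fun _ => (fun _ => 1, fun _ => 1))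
  -- pointwise expansion
  have hpt : ∀ P : ZMod m → HalfCfg S S G × HalfCfg S S G,
      Ω P * ∏ t : ZMod m, Real.exp (β * evenActionU ρ (P t).1 (P t).2 (P (t + 1)).1) *
          Real.exp (β * oddActionU ρ (P t).2 (P (t + 1)).1 (P (t + 1)).2) =
        ∑' k : ZMod m → ℕ, Ω P * ∏ t, chainFactor ρ β k P t := fun P => by
    rw [← ((hasSum_prod_chainFactor ρ hβ hρu P).mul_left (Ω P)).tsum_eq]
  simp_rw [hpt]
  obtain ⟨Bc, hBc⟩ := exists_hasSum_abs_prod_chainFactor_le (S := S) ρ hρ hβ m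
  have hmeas : ∀ k : ZMod m → ℕ, Measurable fun P : ZMod m → HalfCfg S S G × HalfCfg S S G => Ω P * ∏ t, chainFactor ρ β k P t :=
    fun k => hΩm.mul (Finset.measurable_prod _ fun t _ => measurable_chainFactor ρ hρ β k t)
  have hmeas' : ∀ k : ZMod m → ℕ, Measurable fun P : ZMod m → HalfCfg S S G × HalfCfg S S G =>
      ENNReal.ofReal |Ω P * ∏ t, chainFactor ρ β k P t| := fun k => ENNReal.measurable_ofReal.comp (hmeas k).abs
  refine integral_tsum (fun k => (hmeas k).aestronglyMeasurable) (ne_of_lt ?_)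
  have hswap : ∑' k : ZMod m → ℕ, ∫⁻ P, ‖Ω P * ∏ t, chainFactor ρ β k P t‖ₑ
        ∂(Measure.pi fun _ : ZMod m => (halfHaar S G).prod (halfHaar S G)) =
      ∫⁻ P, ∑' k : ZMod m → ℕ, ENNReal.ofReal |Ω P * ∏ t, chainFactor ρ β k P t|
        ∂(Measure.pi fun _ : ZMod m => (halfHaar S G).prod (halfHaar S G)) := by
    rw [lintegral_tsum fun k => (hmeas' k).aemeasurable]
    refine tsum_congr fun k => lintegral_congr fun P => ?_
    rw [Real.enorm_eq_ofReal_abs]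
  rw [hswap]
  calc ∫⁻ P, ∑' k : ZMod m → ℕ, ENNReal.ofReal |Ω P * ∏ t, chainFactor ρ β k P t|
        ∂(Measure.pi fun _ => (halfHaar S G).prod (halfHaar S G))
      ≤ ∫⁻ _P, ENNReal.ofReal (B * Bc) ∂(Measure.pi fun _ : ZMod m => (halfHaar S G).prod (halfHaar S G)) := by
        refine lintegral_mono fun P => ?_
        obtain ⟨s, hs, hsB⟩ := hBc P
        have hs' : HasSum (fun k : ZMod m → ℕ => |Ω P * ∏ t, chainFactor ρ β k P t|) (|Ω P| * s) := by
          simpa only [abs_mul] using hs.mul_left |Ω P|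
        rw [← ENNReal.ofReal_tsum_of_nonneg (fun k => abs_nonneg _) hs'.summable, hs'.tsum_eq]
        refine ENNReal.ofReal_le_ofReal ?_
        have hs0 : 0 ≤ s := hs.nonneg fun k => abs_nonneg _
        exact mul_le_mul (hΩb P) hsB hs0 hB0
    _ = ENNReal.ofReal (B * Bc) := by rw [lintegral_const, measure_univ, mul_one]
    _ < ⊤ := ENNReal.ofReal_lt_top

/-- Step 3 (zip + Fubini, `X` outside): for each feature multi-index `k`,
`∫ Ω(P) ∏_t chainFactor_k P t dP = ∫_X ∫_Y Ω((Y_t,X_t)_t) ∏_t chainFactor_k (Y,X) t dY dX`. -/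
theorem integral_obs_mul_prod_chainFactor_eq (hρ : Continuous ρ) {β : ℝ} (hβ : 0 ≤ β) {m : ℕ} [NeZero m]
    (k : ZMod m → ℕ) {Ω : (ZMod m → HalfCfg S S G × HalfCfg S S G) → ℝ} (hΩm : Measurable Ω) {B : ℝ} (hΩb : ∀ P, |Ω P| ≤ B) :
    ∫ P : ZMod m → HalfCfg S S G × HalfCfg S S G, Ω P * ∏ t, chainFactor ρ β k P t
        ∂(Measure.pi fun _ : ZMod m => (halfHaar S G).prod (halfHaar S G)) =
      ∫ X : ZMod m → HalfCfg S S G, ∫ Y : ZMod m → HalfCfg S S G,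
          Ω (fun t => (Y t, X t)) * ∏ t, chainFactor ρ β k (fun t => (Y t, X t)) t
        ∂(Measure.pi fun _ => halfHaar S G) ∂(Measure.pi fun _ => halfHaar S G) := by
  haveI : IsFiniteMeasure (halfHaar S G) := by unfold halfHaar; infer_instance
  have hB0 : 0 ≤ B := (abs_nonneg _).trans (hΩb fun _ => (fun _ => 1, fun _ => 1))
  have hmp := measurePreserving_arrowProdEquivProdArrow (HalfCfg S S G) (HalfCfg S S G) (ZMod m)
    (fun _ => halfHaar S G) (fun _ => halfHaar S G)
  have hF : Measurable fun P : ZMod m → HalfCfg S S G × HalfCfg S S G => Ω P * ∏ t, chainFactor ρ β k P t :=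
    hΩm.mul (Finset.measurable_prod _ fun t _ => measurable_chainFactor ρ hρ β k t)
  have step1 : ∫ P : ZMod m → HalfCfg S S G × HalfCfg S S G, Ω P * ∏ t, chainFactor ρ β k P t
        ∂(Measure.pi fun _ : ZMod m => (halfHaar S G).prod (halfHaar S G)) =
      ∫ q : (ZMod m → HalfCfg S S G) × (ZMod m → HalfCfg S S G),
          Ω (fun t => (q.1 t, q.2 t)) * ∏ t, chainFactor ρ β k (fun t => (q.1 t, q.2 t)) t
        ∂((Measure.pi fun _ : ZMod m => halfHaar S G).prod (Measure.pi fun _ : ZMod m => halfHaar S G)) :=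
    ((hmp.symm _).integral_comp' (fun P => Ω P * ∏ t, chainFactor ρ β k P t)).symm
  have hf : Integrable (fun q : (ZMod m → HalfCfg S S G) × (ZMod m → HalfCfg S S G) =>
      Ω (fun t => (q.1 t, q.2 t)) * ∏ t, chainFactor ρ β k (fun t => (q.1 t, q.2 t)) t)
      ((Measure.pi fun _ : ZMod m => halfHaar S G).prod (Measure.pi fun _ : ZMod m => halfHaar S G)) := by
    obtain ⟨Bc, hBc⟩ := exists_hasSum_abs_prod_chainFactor_le ρ hρ hβ m (S := S) (G := G)
    have hmeas : Measurable fun q : (ZMod m → HalfCfg S S G) × (ZMod m → HalfCfg S S G) =>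
        Ω (fun t => (q.1 t, q.2 t)) * ∏ t, chainFactor ρ β k (fun t => (q.1 t, q.2 t)) t :=
      hF.comp (MeasurableEquiv.arrowProdEquivProdArrow (HalfCfg S S G) (HalfCfg S S G) (ZMod m)).symm.measurable
    refine Integrable.of_bound hmeas.aestronglyMeasurable (B * Bc) (ae_of_all _ fun q => ?_)
    obtain ⟨s, hs, hsB⟩ := hBc (fun t => (q.1 t, q.2 t))
    rw [Real.norm_eq_abs, abs_mul]
    have hs0 : 0 ≤ s := hs.nonneg fun k => abs_nonneg _
    exact mul_le_mul (hΩb _) ((le_hasSum hs k fun j _ => abs_nonneg _).trans hsB) (abs_nonneg _) hB0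
  rw [step1, integral_prod_symm _ hf]

omit [CompactSpace G] in
/-- The lifted-site integrand of the observable chain is jointly measurable in `(V, Y)`. -/
theorem measurable_prod_openLink_mul_obs (hρ : Continuous ρ) (β M : ℝ) {m : ℕ} [NeZero m]
    {Ω : (ZMod m → HalfCfg S S G × HalfCfg S S G) → ℝ} (hΩm : Measurable Ω) :
    Measurable fun q : (ZMod m → ℕ × HalfCfg S S G) × (ZMod m → HalfCfg S S G) =>
      (∏ t, openLink ρ β M (q.1 (t - 1)) (q.1 t) (q.2 t)) * Ω (fun t => (q.2 t, (q.1 t).2)) := by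
  refine (Finset.measurable_prod _ fun t _ => ?_).mul ?_
  · have h := (measurable_openLink (S := S) ρ hρ β M).comp
      (((measurable_pi_apply (t - 1)).comp measurable_fst).prodMk
        (((measurable_pi_apply t).comp measurable_fst).prodMk ((measurable_pi_apply t).comp measurable_snd)) :
        Measurable fun q : (ZMod m → ℕ × HalfCfg S S G) × (ZMod m → HalfCfg S S G) => (q.1 (t - 1), q.1 t, q.2 t))
    simpa only [Function.comp_def] using h
  · have h := hΩm.comp (measurable_pi_lambda _ fun t =>
      ((measurable_pi_apply t).comp measurable_snd).prodMk (measurable_snd.comp ((measurable_pi_apply t).comp measurable_fst)) :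
        Measurable fun q : (ZMod m → ℕ × HalfCfg S S G) × (ZMod m → HalfCfg S S G) => fun t => (q.2 t, (q.1 t).2))
    simpa only [Function.comp_def] using h

/-- ★ **The `K_u`-chain with an observable inserted, over lifted sites** (`β ≥ 0`, `ρ` continuous unitary, `|w(Y)_j| ≤ M`): for every
bounded measurable observable `Ω` of the pair string,
`∫ Ω(P) ∏_t e^{β even_t} e^{β odd_t} dP = ∫ [∫ (∏_t openLink(V_{t-1}, V_t)(Y_t)) · Ω((Y_t, X(V_t))_t) dY] dμ̃^{⊗ℤ/mℤ}(V)`. -/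
theorem integral_obs_mul_pairChain_eq (hρ : Continuous ρ) {β : ℝ} (hβ : 0 ≤ β)
    (hρu : ∀ g, ρ g ∈ Matrix.unitaryGroup (Fin Nc) ℂ) {M : ℝ}
    (hM : ∀ (Y : HalfCfg S S G) (j : Fin (featDim S Nc)), |bondVec ρ Y j| ≤ M) {m : ℕ} [NeZero m]
    {Ω : (ZMod m → HalfCfg S S G × HalfCfg S S G) → ℝ} (hΩm : Measurable Ω) {B : ℝ} (hΩb : ∀ P, |Ω P| ≤ B) :
    ∫ P : ZMod m → HalfCfg S S G × HalfCfg S S G,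
        Ω P * ∏ t : ZMod m, Real.exp (β * evenActionU ρ (P t).1 (P t).2 (P (t + 1)).1) *
          Real.exp (β * oddActionU ρ (P t).2 (P (t + 1)).1 (P (t + 1)).2)
        ∂(Measure.pi fun _ : ZMod m => (halfHaar S G).prod (halfHaar S G)) =
      ∫ V : ZMod m → ℕ × HalfCfg S S G, (∫ Y : ZMod m → HalfCfg S S G,
          (∏ t, openLink ρ β M (V (t - 1)) (V t) (Y t)) * Ω (fun t => (Y t, (V t).2)) ∂(Measure.pi fun _ => halfHaar S G))
        ∂(Measure.pi fun _ => tMeasure S G Nc β M) := by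
  haveI : IsProbabilityMeasure (halfHaar S G) := by unfold halfHaar; infer_instance
  have hB0 : 0 ≤ B := (abs_nonneg _).trans (hΩb fun _ => (fun _ => 1, fun _ => 1))
  obtain ⟨C, hC0, hC⟩ := exists_abs_openLink_le ρ hρ β hM
  -- the right-hand side as a weighted sum over the discrete coordinates
  have hGm : Measurable fun V : ZMod m → ℕ × HalfCfg S S G => ∫ Y : ZMod m → HalfCfg S S G,
      (∏ t, openLink ρ β M (V (t - 1)) (V t) (Y t)) * Ω (fun t => (Y t, (V t).2)) ∂(Measure.pi fun _ => halfHaar S G) := by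
    have h := (measurable_prod_openLink_mul_obs (S := S) ρ hρ β M hΩm).stronglyMeasurable.integral_prod_right'
      (ν := Measure.pi fun _ : ZMod m => halfHaar S G)
    exact h.measurable
  have hGb : ∀ V : ZMod m → ℕ × HalfCfg S S G, |∫ Y : ZMod m → HalfCfg S S G,
      (∏ t, openLink ρ β M (V (t - 1)) (V t) (Y t)) * Ω (fun t => (Y t, (V t).2)) ∂(Measure.pi fun _ => halfHaar S G)| ≤
      C ^ m * B := fun V => by
    have h := norm_integral_le_of_norm_le_const (μ := Measure.pi fun _ : ZMod m => halfHaar S G)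
      (f := fun Y : ZMod m → HalfCfg S S G => (∏ t, openLink ρ β M (V (t - 1)) (V t) (Y t)) * Ω (fun t => (Y t, (V t).2)))
      (C := C ^ m * B) (ae_of_all _ fun Y => ?_)
    · rwa [probReal_univ, mul_one, Real.norm_eq_abs] at h
    · rw [Real.norm_eq_abs, abs_mul, Finset.abs_prod]
      refine mul_le_mul ?_ (hΩb _) (abs_nonneg _) (by positivity)
      calc ∏ t, |openLink ρ β M (V (t - 1)) (V t) (Y t)| ≤ ∏ _t : ZMod m, C :=
            Finset.prod_le_prod (fun t _ => abs_nonneg _) fun t _ => hC _ _ _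
        _ = C ^ m := by rw [Finset.prod_const, Finset.card_univ, ZMod.card]
  rw [integral_tMeasure_pi_eq_tsum (S := S) (Nc := Nc) hβ M hGm hGb, integral_obs_mul_pairChain_eq_tsum ρ hρ hβ hρu hΩm hΩb]
  refine tsum_congr fun k => ?_
  rw [integral_obs_mul_prod_chainFactor_eq ρ hρ hβ k hΩm hΩb]
  refine integral_congr_ae (ae_of_all _ fun X => ?_)
  dsimp only
  rw [← integral_const_mul]
  refine integral_congr_ae (ae_of_all _ fun Y => ?_)
  dsimp only
  rw [prod_chainFactor_eq, ← prod_featWeight_mul_prod_openLink ρ β M k X Y]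
  ring

end ObsChain

end Summit.QuantumFields.YangMills.Cruxes.DiagonalMirrorRPR.SignTwistedDiagonalTrace.WilsonDiagonal

end
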